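import Summits.NavierStokesRegularity.NavierStokesRegularity.Theorems.AxisymmetricExtremalityAxisymmetricKatoGlobalStubSeregin2020TypeIILemma22AxisMeasure
import Summits.NavierStokesRegularity.NavierStokesRegularity.Theorems.AxisymmetricExtremalityAxisymmetricKatoGlobalStubSeregin2020TypeIILemma22ExpansionOfPositivityV2
import Summits.NavierStokesRegularity.NavierStokesRegularity.Theorems.AxisymmetricExtremalityAxisymmetricKatoGlobalStubSeregin2020TypeIILemma22DensityAtom
import Summits.NavierStokesRegularity.NavierStokesRegularity.Theorems.AxisymmetricExtremalityAxisymmetricKatoGlobalStubSeregin2020TypeIILemma22ShrinkingAtom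
import Summits.NavierStokesRegularity.NavierStokesRegularity.Theorems.AxisymmetricExtremalityAxisymmetricKatoGlobalStubSeregin2020TypeIILemma22AssemblyTools
import Summits.NavierStokesRegularity.NavierStokesRegularity.Theorems.AxisymmetricExtremalityAxisymmetricKatoGlobalStubSeregin2020TypeIISwirlVanishesV2Final
import HarnessLib

/-!
# Seregin 2020, Theorem 2.1 via Lemma 2.2: the ASSEMBLY of the written-out Lemma 2.2 (`hWH′`)
# from the measure estimate (L22-A), the expansion of positivity (L22-C) and the energy class (L22-B)

Toward the stub `stub_seregin2020TypeII` of the crux `AxisymmetricKatoGlobal` (= the named fact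
`Literature.Analysis.FluidPDE.Seregin2020_axisymmetricSingularPoint_typeII`, G. Seregin, Anal.
Math. Phys. 10 (2020) Paper 46 = arXiv:2006.04140, Thm 2.1). In the tree Thm 2.1 is reduced
(`blowupIndex_eq_top_of_weakHarnack'`) to its written-out 9th hypothesis `hWH′` = the corrected
Lemma 2.2 (Nazarov–Uraltseva 2012, Lemma 4.2 for Seregin's class 𝒱). This file assembles `hWH′`
from the cell's cut (pub/ns-inputs/kits/A1.md §2′):

* L22-A `axis_measure_estimate` (landed) — N–U (4.6)–(4.8): `|{Φ > ϰk} ∩ [-R²,-¾R²]×B_R| ≥ δR⁵`;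
* L22-C `lemma22_expansionOfPositivity_of_atoms` (landed, seat c) with the landed atoms
  `lemma22_densityPropagation`, `lemma22_shrinking` (seat b), modulo the registered Moser atom
  `lemma22_smallSublevel_lowerBound` (seat c) — taken here as the hypothesis `hL31`, verbatim;
* L22-B, the energy-inequality class (N–U (3.3), Seregin §3) for the NORMALISED pair
  `Φ̃ = Φ` on `{t < 0} ∖ S`, `= k` elsewhere; `Ũ = U` on `{t < 0, ϱ ≠ 0}`, `= 0` elsewhere
  (kits/A1.md item 9) — taken here as the hypothesis `hEC` (raw class-𝒱 binders ⟹ the registered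
  `EnergyClass` text for `Φ̃, Ũ`; seats es-p1/ser-b, kits/A1-L22B.md), since it is not landed yet.

Main results:

* `lemma22_of_moser_and_energyClass` — `hL31 → hEC → hWH′` (the statement of `hWH′` byte for
  byte; `β(M,N) = β₃(δ(M,N),N)·ϰ(M,N)`), with the transfers `u = U` a.e., the normalisation lemmas and the null-set bookkeeping of
  `…Lemma22AssemblyTools`;
* `seregin2020_typeII_of_moser_and_energyClass` — `hL31 → hEC →
  Seregin2020_axisymmetricSingularPoint_typeII` (composition with `blowupIndex_eq_top_of_weakHarnack'`).

This is a CONDITIONAL assembly: the named input becomes unconditional exactly when the two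
registered/kit pieces `hL31` (Moser iteration, N–U Lemma 3.1) and `hEC` (energy class) land. No NS
regularity statement is proved here; a printed theorem is being re-proved as an INPUT.

## References

* G. Seregin, Anal. Math. Phys. 10 (2020), Paper 46 = arXiv:2006.04140, Thm 2.1, Lemma 2.2, §3.
  [Seregin2020]
* A. I. Nazarov, N. N. Uraltseva, St. Petersburg Math. J. 23 (2012) 93–115 = arXiv:1011.1888,
  Lemma 3.1, Cor 3.3, Lemma 4.2. [NazarovUraltseva2012]
-/

-- the problem directory repeats the summit name (D-0017); core's `dupNamespace` linter fires
set_option linter.dupNamespace false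

noncomputable section

open MeasureTheory Set Function Filter Topology TopologicalSpace Metric
open scoped NNReal ENNReal InnerProductSpace

namespace Summit.NavierStokesRegularity.NavierStokesRegularity.Theorems.AxisymmetricKatoGlobal.EulerScaling

open Literature.Analysis.FluidPDE Literature.Analysis.FluidPDE.Seregin2020
  Literature.Analysis.FluidPDE.SereginZajaczkowski2007

/-! ### The assembly -/

/-- **Seregin 2020, Lemma 2.2 (corrected; = `hWH′` of `blowupIndex_eq_top_of_weakHarnack'`,
byte for byte), assembled** from the landed measure estimate `axis_measure_estimate` (N–U (4.8)),
the landed composition `lemma22_expansionOfPositivity_of_atoms` with the landed atoms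
`lemma22_densityPropagation`, `lemma22_shrinking`, the registered Moser atom
`lemma22_smallSublevel_lowerBound` as hypothesis `hL31` (verbatim), and the energy class of the
normalised pair `(Φ̃, Ũ)` as hypothesis `hEC` (kits/A1-L22B.md): `β(M, N) = β₃(δ, N)·ϰ(M, N)`.
CONDITIONAL on `hL31`, `hEC`. [cite: Seregin2020, Lemma 2.2; NazarovUraltseva2012, Lemma 4.2, Cor 3.3, Lemma 3.1] -/
theorem lemma22_of_moser_and_energyClass
    (hL31 : ∀ (lamlo θlo θhi : ℝ) (N : ℝ≥0), 1 < lamlo → lamlo ≤ 2 → 0 < θlo → θlo ≤ θhi →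
      ∃ μ₁ : ℝ, 0 < μ₁ ∧
      ∀ (Φ : ℝ → EuclideanSpace ℝ (Fin 3) → ℝ) (U : ℝ → EuclideanSpace ℝ (Fin 3) → EuclideanSpace ℝ (Fin 3))
        (S : Set (ℝ × EuclideanSpace ℝ (Fin 3))) (k R : ℝ), (0 < k ∧ 0 < R ∧ Measurable (uncurry Φ) ∧ AEStronglyMeasurable (uncurry U) volume ∧
          IsClosed S ∧ (∀ z ∈ S, cylRadius z.2 = 0) ∧ ContinuousOn (uncurry Φ) ({z : ℝ ×
          EuclideanSpace ℝ (Fin 3) | z.1 < 0} \ S) ∧ (∀ t x, 0 ≤ Φ t x) ∧ (∀ᵐ t : ℝ, t ∈ Ioo (-R ^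
          2) 0 → ContDiff ℝ 1 (Φ t)) ∧ (∫⁻ s in Ioo (-R ^ 2) 0, (∫⁻ y in ball (0 : EuclideanSpace ℝ
          (Fin 3)) (2 * R), ‖U s y‖ₑ ^ (3 : ℕ)) ^ (4 / 3 : ℝ) ≤ (N : ℝ≥0∞) * ENNReal.ofReal R ^ 2) ∧
          (∀ (H : ℝ → ℝ), ContDiff ℝ 2 H → (∀ v, deriv H v ≤ 0) → (∀ v, 0 ≤ H v) → (∀ v, 0 ≤ deriv
          (deriv H) v) → (∀ v, deriv H v ^ 2 ≤ 2 * H v * deriv (deriv H) v) → (∀ v, k ≤ v → H v = 0)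
          → ∀ (Θ : EuclideanSpace ℝ (Fin 3) → ℝ), ContDiff ℝ 1 Θ → HasCompactSupport Θ → tsupport Θ
          ⊆ ball (0 : EuclideanSpace ℝ (Fin 3)) (2 * R) → ∀ (η : ℝ → ℝ), ContDiff ℝ 1 η → (∀ s, 0 ≤
          η s) → ∀ (t₁ t₂ : ℝ), -R ^ 2 < t₁ → t₁ ≤ t₂ → t₂ < 0 → ENNReal.ofReal (η t₂ * ∫ x, H (Φ t₂
          x) * Θ x ^ 2) + ∫⁻ z in Icc t₁ t₂ ×ˢ (univ : Set (EuclideanSpace ℝ (Fin 3))),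
          ENNReal.ofReal (1 / 2 * η z.1 * (deriv (deriv H) (Φ z.1 z.2) * ‖gradient (Φ z.1) z.2‖ ^ 2
          * Θ z.2 ^ 2)) ≤ ENNReal.ofReal (η t₁ * (∫ x, H (Φ t₁ x) * Θ x ^ 2) + (4 * ∫ z in Icc t₁ t₂
          ×ˢ (univ : Set (EuclideanSpace ℝ (Fin 3))), η z.1 * (H (Φ z.1 z.2) * ‖gradient Θ z.2‖ ^
          2)) + (∫ z in Icc t₁ t₂ ×ˢ (univ : Set (EuclideanSpace ℝ (Fin 3))), η z.1 * (H (Φ z.1 z.2)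
          * inner ℝ (U z.1 z.2) (gradient (fun y => Θ y ^ 2) z.2))) + (∫ z in Icc t₁ t₂ ×ˢ (univ :
          Set (EuclideanSpace ℝ (Fin 3))), η z.1 * (2 / cylRadius z.2 * (H (Φ z.1 z.2) * fderiv ℝ
          (fun y => Θ y ^ 2) z.2 (eR z.2)))) + (∫ z in Icc t₁ t₂ ×ˢ (univ : Set (EuclideanSpace ℝ
          (Fin 3))), |deriv η z.1| * (H (Φ z.1 z.2) * Θ z.2 ^ 2))))) →
      ∀ (lam ρ θ t₀ l : ℝ), lamlo ≤ lam → lam ≤ 2 → R / 4 ≤ ρ → lam * ρ ≤ 2 * R → θlo ≤ θ → θ ≤ θhi →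
        t₀ ≤ 0 → -R ^ 2 < t₀ - θ * ρ ^ 2 → 0 < l → l ≤ k →
        volume {z : ℝ × EuclideanSpace ℝ (Fin 3) |
            z ∈ Ioo (t₀ - θ * ρ ^ 2) t₀ ×ˢ ball (0 : EuclideanSpace ℝ (Fin 3)) (lam * ρ) ∧ Φ z.1 z.2 < l}
          ≤ ENNReal.ofReal μ₁ * volume (Ioo (t₀ - θ * ρ ^ 2) t₀ ×ˢ ball (0 : EuclideanSpace ℝ (Fin 3)) (lam * ρ)) →
        (∀ᵐ z ∂(volume.restrict (Ioo (t₀ - θ / 2 * ρ ^ 2) t₀ ×ˢ ball (0 : EuclideanSpace ℝ (Fin 3)) ρ)),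
            l / 2 ≤ Φ z.1 z.2) ∧
        ((∀ᵐ x ∂(volume.restrict (ball (0 : EuclideanSpace ℝ (Fin 3)) (lam * ρ))), l ≤ Φ (t₀ - θ * ρ ^ 2) x) →
          ∀ᵐ z ∂(volume.restrict (Ioo (t₀ - θ * ρ ^ 2) t₀ ×ˢ ball (0 : EuclideanSpace ℝ (Fin 3)) ρ)),
            l / 2 ≤ Φ z.1 z.2))
    (hEC : ∀ (U U' : ℝ → EuclideanSpace ℝ (Fin 3) → EuclideanSpace ℝ (Fin 3)) (Φ Φ' : ℝ → EuclideanSpace ℝ (Fin 3) → ℝ)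
      (S : Set (ℝ × EuclideanSpace ℝ (Fin 3))) (R k : ℝ) (N : ℝ≥0),
    ContinuousOn (uncurry U) {z : ℝ × EuclideanSpace ℝ (Fin 3) | z.1 < 0 ∧ cylRadius z.2 ≠ 0} →
    (∀ z : ℝ × EuclideanSpace ℝ (Fin 3), z.1 < 0 → cylRadius z.2 ≠ 0 → ContDiffAt ℝ (⊤ : ℕ∞) (U z.1) z.2) →
    ContinuousOn (fun z : ℝ × EuclideanSpace ℝ (Fin 3) => fderiv ℝ (U z.1) z.2) {z : ℝ × EuclideanSpace ℝ (Fin 3) | z.1 < 0 ∧ cylRadius z.2 ≠ 0} →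
    (∀ z : ℝ × EuclideanSpace ℝ (Fin 3), z.1 < 0 → cylRadius z.2 ≠ 0 → VectorCalculus.divergence (U z.1) z.2 = 0) →
    (∀ a : ℝ, 0 < a → ∫⁻ z in parabolicCylinder a (0 : ℝ × EuclideanSpace ℝ (Fin 3)), ‖U z.1 z.2‖ₑ ^ (3 : ℕ) < ∞) →
    IsClosed S → (∀ z ∈ S, z.1 ≤ 0 ∧ cylRadius z.2 = 0) → IsParabolicNull 1 S →
    ContinuousOn (uncurry Φ) ({z : ℝ × EuclideanSpace ℝ (Fin 3) | z.1 < 0} \ S) →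
    (∀ z : ℝ × EuclideanSpace ℝ (Fin 3), z.1 < 0 → z ∉ S → ContDiffAt ℝ (⊤ : ℕ∞) (Φ z.1) z.2) →
    ContinuousOn (fun z : ℝ × EuclideanSpace ℝ (Fin 3) => fderiv ℝ (Φ z.1) z.2) ({z : ℝ × EuclideanSpace ℝ (Fin 3) | z.1 < 0} \ S) →
    (∀ e : EuclideanSpace ℝ (Fin 3), ContinuousOn (fun z : ℝ × EuclideanSpace ℝ (Fin 3) => fderiv ℝ (fun y => fderiv ℝ (Φ z.1) y e) z.2 e)
      ({z : ℝ × EuclideanSpace ℝ (Fin 3) | z.1 < 0} \ S)) →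
    (∀ z : ℝ × EuclideanSpace ℝ (Fin 3), z.1 < 0 → cylRadius z.2 ≠ 0 → DifferentiableAt ℝ (fun r => Φ r z.2) z.1) →
    ContinuousOn (fun z : ℝ × EuclideanSpace ℝ (Fin 3) => deriv (fun r => Φ r z.2) z.1)
      {z : ℝ × EuclideanSpace ℝ (Fin 3) | z.1 < 0 ∧ cylRadius z.2 ≠ 0} →
    (∀ δ' ρ : ℝ, 0 < δ' → δ' < ρ → ∃ C : ℝ, ∀ z : ℝ × EuclideanSpace ℝ (Fin 3),
      z.1 ∈ Ioo (-ρ ^ 2) 0 → δ' < cylRadius z.2 → cylRadius z.2 < ρ → |z.2 2| < ρ →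
        |deriv (fun r => Φ r z.2) z.1| ≤ C ∧ ‖fderiv ℝ (Φ z.1) z.2‖ ≤ C ∧
        ∀ e : EuclideanSpace ℝ (Fin 3), ‖e‖ ≤ 1 → |fderiv ℝ (fun y => fderiv ℝ (Φ z.1) y e) z.2 e| ≤ C) →
    (∃ B : ℝ, ∀ z : ℝ × EuclideanSpace ℝ (Fin 3), z.1 < 0 → z ∉ S → |Φ z.1 z.2| ≤ B) →
    (∀ z : ℝ × EuclideanSpace ℝ (Fin 3), z.1 < 0 → z ∉ S → 0 ≤ Φ z.1 z.2) →
    (∀ z : ℝ × EuclideanSpace ℝ (Fin 3), z.1 < 0 → cylRadius z.2 ≠ 0 →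
      0 ≤ deriv (fun r => Φ r z.2) z.1 + fderiv ℝ (Φ z.1) z.2 (U z.1 z.2) +
          2 / cylRadius z.2 * partialDeriv (eR z.2) (Φ z.1) z.2 - (Laplacian.laplacian (Φ z.1)) z.2) →
    0 < R → 0 < k →
    (∫⁻ s in Ioo (-R ^ 2) 0, (∫⁻ y in ball (0 : EuclideanSpace ℝ (Fin 3)) (2 * R), ‖U s y‖ₑ ^ (3 : ℕ)) ^ (4 / 3 : ℝ) ≤
      (N : ℝ≥0∞) * ENNReal.ofReal R ^ 2) →
    (∀ z : ℝ × EuclideanSpace ℝ (Fin 3), z.1 ∈ Ioo (-R ^ 2) 0 → cylRadius z.2 = 0 →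
      z.2 2 ∈ Ioo (-(2 * R)) (2 * R) → z ∉ S → k ≤ Φ z.1 z.2) →
    (∀ t x, t < 0 → (t, x) ∉ S → Φ' t x = Φ t x) → (∀ t x, ¬ (t < 0 ∧ (t, x) ∉ S) → Φ' t x = k) →
    (∀ t x, t < 0 → cylRadius x ≠ 0 → U' t x = U t x) → (∀ t x, ¬ (t < 0 ∧ cylRadius x ≠ 0) → U' t x = 0) →
    (∀ (H : ℝ → ℝ), ContDiff ℝ 2 H → (∀ v, deriv H v ≤ 0) → (∀ v, 0 ≤ H v) → (∀ v, 0 ≤ deriv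
          (deriv H) v) → (∀ v, deriv H v ^ 2 ≤ 2 * H v * deriv (deriv H) v) → (∀ v, k ≤ v → H v = 0)
          → ∀ (Θ : EuclideanSpace ℝ (Fin 3) → ℝ), ContDiff ℝ 1 Θ → HasCompactSupport Θ → tsupport Θ
          ⊆ ball (0 : EuclideanSpace ℝ (Fin 3)) (2 * R) → ∀ (η : ℝ → ℝ), ContDiff ℝ 1 η → (∀ s, 0 ≤
          η s) → ∀ (t₁ t₂ : ℝ), -R ^ 2 < t₁ → t₁ ≤ t₂ → t₂ < 0 → ENNReal.ofReal (η t₂ * ∫ x, H (Φ' t₂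
          x) * Θ x ^ 2) + ∫⁻ z in Icc t₁ t₂ ×ˢ (univ : Set (EuclideanSpace ℝ (Fin 3))),
          ENNReal.ofReal (1 / 2 * η z.1 * (deriv (deriv H) (Φ' z.1 z.2) * ‖gradient (Φ' z.1) z.2‖ ^ 2
          * Θ z.2 ^ 2)) ≤ ENNReal.ofReal (η t₁ * (∫ x, H (Φ' t₁ x) * Θ x ^ 2) + (4 * ∫ z in Icc t₁ t₂
          ×ˢ (univ : Set (EuclideanSpace ℝ (Fin 3))), η z.1 * (H (Φ' z.1 z.2) * ‖gradient Θ z.2‖ ^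
          2)) + (∫ z in Icc t₁ t₂ ×ˢ (univ : Set (EuclideanSpace ℝ (Fin 3))), η z.1 * (H (Φ' z.1 z.2)
          * inner ℝ (U' z.1 z.2) (gradient (fun y => Θ y ^ 2) z.2))) + (∫ z in Icc t₁ t₂ ×ˢ (univ :
          Set (EuclideanSpace ℝ (Fin 3))), η z.1 * (2 / cylRadius z.2 * (H (Φ' z.1 z.2) * fderiv ℝ
          (fun y => Θ y ^ 2) z.2 (eR z.2)))) + (∫ z in Icc t₁ t₂ ×ˢ (univ : Set (EuclideanSpace ℝ
          (Fin 3))), |deriv η z.1| * (H (Φ' z.1 z.2) * Θ z.2 ^ 2))))) :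
    ∀ (M : ℝ) (N : ℝ≥0), ∃ β : ℝ, 0 < β ∧
  ∀ (u U : ℝ → EuclideanSpace ℝ (Fin 3) → EuclideanSpace ℝ (Fin 3))
    (p : ℝ → EuclideanSpace ℝ (Fin 3) → ℝ) (K : ℝ≥0)
    (Φ : ℝ → EuclideanSpace ℝ (Fin 3) → ℝ) (S : Set (ℝ × EuclideanSpace ℝ (Fin 3))) (R k : ℝ),
    (∀ s, IsAxisymmetric (u s)) → (∀ s, IsAxisymmetricScalar (p s)) →
    (∀ a : ℝ, 0 < a →
      IsSuitableWeakSolutionInBall a 0 u p ∧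
      cknAEss a 0 u ≤ K ∧
      cknC a 0 u ≤ K ∧
      cknD a 0 p ≤ K ∧
      ∃ G' : ℝ → EuclideanSpace ℝ (Fin 3) →
          EuclideanSpace ℝ (Fin 3) →L[ℝ] EuclideanSpace ℝ (Fin 3),
        HasWeakSpatialGradientOn (parabolicCylinderOpens (2 * a) 0) u G' ∧
          cknAEss a 0 u + cknE a 0 G' ≤ K) →
    uncurry u =ᵐ[volume.restrict {z : ℝ × EuclideanSpace ℝ (Fin 3) | z.1 < 0}] uncurry U →
    ContinuousOn (uncurry U)
      {z : ℝ × EuclideanSpace ℝ (Fin 3) | z.1 < 0 ∧ cylRadius z.2 ≠ 0} →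
    (∀ z : ℝ × EuclideanSpace ℝ (Fin 3), z.1 < 0 → cylRadius z.2 ≠ 0 →
      ContDiffAt ℝ (⊤ : ℕ∞) (U z.1) z.2) →
    ContinuousOn (fun z : ℝ × EuclideanSpace ℝ (Fin 3) => fderiv ℝ (U z.1) z.2)
      {z : ℝ × EuclideanSpace ℝ (Fin 3) | z.1 < 0 ∧ cylRadius z.2 ≠ 0} →
    (∀ z : ℝ × EuclideanSpace ℝ (Fin 3), z.1 < 0 → cylRadius z.2 ≠ 0 →
      VectorCalculus.divergence (U z.1) z.2 = 0) →
    IsClosed S → (∀ z ∈ S, z.1 ≤ 0 ∧ cylRadius z.2 = 0) → IsParabolicNull 1 S →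
    ContinuousOn (uncurry Φ) ({z : ℝ × EuclideanSpace ℝ (Fin 3) | z.1 < 0} \ S) →
    (∀ z : ℝ × EuclideanSpace ℝ (Fin 3), z.1 < 0 → z ∉ S →
      ContDiffAt ℝ (⊤ : ℕ∞) (Φ z.1) z.2) →
    ContinuousOn (fun z : ℝ × EuclideanSpace ℝ (Fin 3) => fderiv ℝ (Φ z.1) z.2)
      ({z : ℝ × EuclideanSpace ℝ (Fin 3) | z.1 < 0} \ S) →
    (∀ e : EuclideanSpace ℝ (Fin 3), ContinuousOn (fun z : ℝ × EuclideanSpace ℝ (Fin 3) =>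
        fderiv ℝ (fun y => fderiv ℝ (Φ z.1) y e) z.2 e)
      ({z : ℝ × EuclideanSpace ℝ (Fin 3) | z.1 < 0} \ S)) →
    (∀ z : ℝ × EuclideanSpace ℝ (Fin 3), z.1 < 0 → cylRadius z.2 ≠ 0 →
      DifferentiableAt ℝ (fun r => Φ r z.2) z.1) →
    ContinuousOn (fun z : ℝ × EuclideanSpace ℝ (Fin 3) => deriv (fun r => Φ r z.2) z.1)
      {z : ℝ × EuclideanSpace ℝ (Fin 3) | z.1 < 0 ∧ cylRadius z.2 ≠ 0} →
    (∀ δ ρ : ℝ, 0 < δ → δ < ρ → ∃ C : ℝ, ∀ z : ℝ × EuclideanSpace ℝ (Fin 3),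
      z.1 ∈ Ioo (-ρ ^ 2) 0 → δ < cylRadius z.2 → cylRadius z.2 < ρ → |z.2 2| < ρ →
        |deriv (fun r => Φ r z.2) z.1| ≤ C ∧ ‖fderiv ℝ (Φ z.1) z.2‖ ≤ C ∧
        ∀ e : EuclideanSpace ℝ (Fin 3), ‖e‖ ≤ 1 →
          |fderiv ℝ (fun y => fderiv ℝ (Φ z.1) y e) z.2 e| ≤ C) →
    (∃ B : ℝ, ∀ z : ℝ × EuclideanSpace ℝ (Fin 3), z.1 < 0 → z ∉ S → |Φ z.1 z.2| ≤ B) →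
    (∀ z : ℝ × EuclideanSpace ℝ (Fin 3), z.1 < 0 → z ∉ S → 0 ≤ Φ z.1 z.2) →
    (∀ z : ℝ × EuclideanSpace ℝ (Fin 3), z.1 < 0 → cylRadius z.2 ≠ 0 →
      0 ≤ deriv (fun r => Φ r z.2) z.1 + fderiv ℝ (Φ z.1) z.2 (U z.1 z.2) +
          2 / cylRadius z.2 * partialDeriv (eR z.2) (Φ z.1) z.2 - (Laplacian.laplacian (Φ z.1)) z.2) →
    0 < R → 0 < k → 1 ≤ M →
    (∫⁻ s in Ioo (-R ^ 2) 0, (∫⁻ y in ball (0 : EuclideanSpace ℝ (Fin 3)) (2 * R),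
        ‖u s y‖ₑ ^ (3 : ℕ)) ^ (4 / 3 : ℝ) ≤ (N : ℝ≥0∞) * ENNReal.ofReal R ^ 2) →
    (∀ z : ℝ × EuclideanSpace ℝ (Fin 3), z.1 ∈ Ioo (-R ^ 2) 0 → cylRadius z.2 = 0 →
      z.2 2 ∈ Ioo (-(2 * R)) (2 * R) → z ∉ S → k ≤ Φ z.1 z.2) →
    (∀ z : ℝ × EuclideanSpace ℝ (Fin 3), z.1 ∈ Ioo (-R ^ 2) 0 →
      z.2 ∈ ball (0 : EuclideanSpace ℝ (Fin 3)) (2 * R) → z ∉ S → Φ z.1 z.2 ≤ M * k) →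
    ∀ᵐ z ∂(volume.restrict (parabolicCylinder (R / 2) (0 : ℝ × EuclideanSpace ℝ (Fin 3)))),
      β * k ≤ Φ z.1 z.2 := by
  intro M N
  obtain ⟨ϰ, δ, hϰ0, hϰ1, hδ0, hA⟩ := axis_measure_estimate M N
  obtain ⟨β₃, hβ₃, hEP⟩ :=
    lemma22_expansionOfPositivity_of_atoms hL31 lemma22_densityPropagation lemma22_shrinking δ N hδ0
  refine ⟨β₃ * ϰ, mul_pos hβ₃ hϰ0, ?_⟩
  intro u U p K Φ S R k hu_ax hp_ax hAll hae hUc hUs hUg hdiv hS hSax hSnull hΦc hΦs hΦg hΦ2 hΦt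
    hΦt' hbd hB hpos hsup hR hk hM hN hax hup
  classical
  -- `u = U` a.e.: local `L³` and the drift bound for `U`
  have hU3 : ∀ a : ℝ, 0 < a → ∫⁻ z in parabolicCylinder a (0 : ℝ × EuclideanSpace ℝ (Fin 3)), ‖U z.1 z.2‖ₑ ^ (3 : ℕ) < ∞ :=
    fun a ha => lintegral_cube_parabolicCylinder_lt_top_of_cknC hae (hAll a ha).2.2.1
  have hNU := driftBound_congr_ae hae hN
  have hSax' : ∀ z ∈ S, cylRadius z.2 = 0 := fun z hz => (hSax z hz).2
  -- the normalised pair `(Φ̃, Ũ)`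
  obtain ⟨Φ', hΦ'⟩ : ∃ Φ' : ℝ → EuclideanSpace ℝ (Fin 3) → ℝ, ∀ t x, Φ' t x = if t < 0 ∧ (t, x) ∉ S then Φ t x else k :=
    ⟨fun t x => if t < 0 ∧ (t, x) ∉ S then Φ t x else k, fun _ _ => rfl⟩
  obtain ⟨U', hU'⟩ : ∃ U' : ℝ → EuclideanSpace ℝ (Fin 3) → EuclideanSpace ℝ (Fin 3), ∀ t x, U' t x = if t < 0 ∧ cylRadius x ≠ 0 then U t x else 0 :=
    ⟨fun t x => if t < 0 ∧ cylRadius x ≠ 0 then U t x else 0, fun _ _ => rfl⟩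
  have hΦ'1 : ∀ t x, t < 0 → (t, x) ∉ S → Φ' t x = Φ t x := fun t x ht hx => by rw [hΦ', if_pos ⟨ht, hx⟩]
  have hΦ'2 : ∀ t x, ¬ (t < 0 ∧ (t, x) ∉ S) → Φ' t x = k := fun t x h => by rw [hΦ', if_neg h]
  have hU'1 : ∀ t x, t < 0 → cylRadius x ≠ 0 → U' t x = U t x := fun t x ht hx => by rw [hU', if_pos ⟨ht, hx⟩]
  have hU'2 : ∀ t x, ¬ (t < 0 ∧ cylRadius x ≠ 0) → U' t x = 0 := fun t x h => by rw [hU', if_neg h]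
  obtain ⟨hΦ'm, hΦ'c, hΦ'0, hΦ'C1⟩ := normalisedPhi_props (R := R) hS hSnull hΦc hΦs hpos hk hΦ'1 hΦ'2
  have hU'm := normalisedDrift_aestronglyMeasurable hUc hU'1 hU'2
  have hNU' := driftBound_congr_ae (ae_eq_normalisedDrift hae hU'1) hN
  have hEC' := hEC U U' Φ Φ' S R k N hUc hUs hUg hdiv hU3 hS hSax hSnull hΦc hΦs hΦg hΦ2 hΦt hΦt' hbd hB
    hpos hsup hR hk hNU hax hΦ'1 hΦ'2 hU'1 hU'2
  -- the measure estimate (L22-A) at the level `ϰk`, moved to `Φ̃`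
  have hvol := hA U Φ S R k hUc hUs hdiv hU3 hS hSax hSnull hΦc hΦs hΦg hΦ2 hΦt hΦt' hB hpos hsup hR hk
    hM hNU hax hup
  have hvol' := hvol.trans (superlevel_volume_le_normalised (κ := ϰ * k) hSax' hR hΦ'1)
  -- expansion of positivity (L22-C) for the normalised pair
  have hfin := hEP Φ' U' S k R ⟨hk, hR, hΦ'm, hU'm, hS, hSax', hΦ'c, hΦ'0, hΦ'C1, hNU', hEC'⟩ (ϰ * k)
    (mul_pos hϰ0 hk) (mul_le_of_le_one_left hk.le hϰ1) hvol'
  -- back to `Φ`: `Φ̃ = Φ` a.e. on `Q(R/2) ⊆ {t < 0}`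
  have hQneg : parabolicCylinder (R / 2) (0 : ℝ × EuclideanSpace ℝ (Fin 3)) ⊆ {z : ℝ × EuclideanSpace ℝ (Fin 3) | z.1 < 0} := fun z hz => by
    rw [mem_parabolicCylinder] at hz
    simpa using hz.1.2
  have haeS : ∀ᵐ z : ℝ × EuclideanSpace ℝ (Fin 3), z ∉ S :=
    measure_eq_zero_iff_ae_notMem.1 (measure_mono_null hSax' volume_setOf_cylRadius_snd_eq_zero)
  have hmem : ∀ᵐ z ∂(volume.restrict (parabolicCylinder (R / 2) (0 : ℝ × EuclideanSpace ℝ (Fin 3)))),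
      z ∈ parabolicCylinder (R / 2) (0 : ℝ × EuclideanSpace ℝ (Fin 3)) :=
    ae_restrict_mem (by unfold parabolicCylinder; exact measurableSet_Ioo.prod measurableSet_ball)
  filter_upwards [hfin, hmem, ae_restrict_of_ae haeS] with z hz hzQ hzS
  rw [hΦ'1 z.1 z.2 (hQneg hzQ) hzS] at hz
  calc β₃ * ϰ * k = β₃ * (ϰ * k) := by ring
    _ ≤ Φ z.1 z.2 := hz

/-- **Seregin 2020, Theorem 2.1 (the named INPUT `Seregin2020_axisymmetricSingularPoint_typeII`),
conditional on the two remaining pieces `hL31` (Moser atom) and `hEC` (energy class):**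
composition of `lemma22_of_moser_and_energyClass` with `blowupIndex_eq_top_of_weakHarnack'`.
No NS regularity statement is proved. [cite: Seregin2020, Thm 2.1] -/
theorem seregin2020_typeII_of_moser_and_energyClass
    (hL31 : ∀ (lamlo θlo θhi : ℝ) (N : ℝ≥0), 1 < lamlo → lamlo ≤ 2 → 0 < θlo → θlo ≤ θhi →
      ∃ μ₁ : ℝ, 0 < μ₁ ∧
      ∀ (Φ : ℝ → EuclideanSpace ℝ (Fin 3) → ℝ) (U : ℝ → EuclideanSpace ℝ (Fin 3) → EuclideanSpace ℝ (Fin 3))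
        (S : Set (ℝ × EuclideanSpace ℝ (Fin 3))) (k R : ℝ), (0 < k ∧ 0 < R ∧ Measurable (uncurry Φ) ∧ AEStronglyMeasurable (uncurry U) volume ∧
          IsClosed S ∧ (∀ z ∈ S, cylRadius z.2 = 0) ∧ ContinuousOn (uncurry Φ) ({z : ℝ ×
          EuclideanSpace ℝ (Fin 3) | z.1 < 0} \ S) ∧ (∀ t x, 0 ≤ Φ t x) ∧ (∀ᵐ t : ℝ, t ∈ Ioo (-R ^
          2) 0 → ContDiff ℝ 1 (Φ t)) ∧ (∫⁻ s in Ioo (-R ^ 2) 0, (∫⁻ y in ball (0 : EuclideanSpace ℝ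
          (Fin 3)) (2 * R), ‖U s y‖ₑ ^ (3 : ℕ)) ^ (4 / 3 : ℝ) ≤ (N : ℝ≥0∞) * ENNReal.ofReal R ^ 2) ∧
          (∀ (H : ℝ → ℝ), ContDiff ℝ 2 H → (∀ v, deriv H v ≤ 0) → (∀ v, 0 ≤ H v) → (∀ v, 0 ≤ deriv
          (deriv H) v) → (∀ v, deriv H v ^ 2 ≤ 2 * H v * deriv (deriv H) v) → (∀ v, k ≤ v → H v = 0)
          → ∀ (Θ : EuclideanSpace ℝ (Fin 3) → ℝ), ContDiff ℝ 1 Θ → HasCompactSupport Θ → tsupport Θ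
          ⊆ ball (0 : EuclideanSpace ℝ (Fin 3)) (2 * R) → ∀ (η : ℝ → ℝ), ContDiff ℝ 1 η → (∀ s, 0 ≤
          η s) → ∀ (t₁ t₂ : ℝ), -R ^ 2 < t₁ → t₁ ≤ t₂ → t₂ < 0 → ENNReal.ofReal (η t₂ * ∫ x, H (Φ t₂
          x) * Θ x ^ 2) + ∫⁻ z in Icc t₁ t₂ ×ˢ (univ : Set (EuclideanSpace ℝ (Fin 3))),
          ENNReal.ofReal (1 / 2 * η z.1 * (deriv (deriv H) (Φ z.1 z.2) * ‖gradient (Φ z.1) z.2‖ ^ 2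
          * Θ z.2 ^ 2)) ≤ ENNReal.ofReal (η t₁ * (∫ x, H (Φ t₁ x) * Θ x ^ 2) + (4 * ∫ z in Icc t₁ t₂
          ×ˢ (univ : Set (EuclideanSpace ℝ (Fin 3))), η z.1 * (H (Φ z.1 z.2) * ‖gradient Θ z.2‖ ^
          2)) + (∫ z in Icc t₁ t₂ ×ˢ (univ : Set (EuclideanSpace ℝ (Fin 3))), η z.1 * (H (Φ z.1 z.2)
          * inner ℝ (U z.1 z.2) (gradient (fun y => Θ y ^ 2) z.2))) + (∫ z in Icc t₁ t₂ ×ˢ (univ :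
          Set (EuclideanSpace ℝ (Fin 3))), η z.1 * (2 / cylRadius z.2 * (H (Φ z.1 z.2) * fderiv ℝ
          (fun y => Θ y ^ 2) z.2 (eR z.2)))) + (∫ z in Icc t₁ t₂ ×ˢ (univ : Set (EuclideanSpace ℝ
          (Fin 3))), |deriv η z.1| * (H (Φ z.1 z.2) * Θ z.2 ^ 2))))) →
      ∀ (lam ρ θ t₀ l : ℝ), lamlo ≤ lam → lam ≤ 2 → R / 4 ≤ ρ → lam * ρ ≤ 2 * R → θlo ≤ θ → θ ≤ θhi →
        t₀ ≤ 0 → -R ^ 2 < t₀ - θ * ρ ^ 2 → 0 < l → l ≤ k →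
        volume {z : ℝ × EuclideanSpace ℝ (Fin 3) |
            z ∈ Ioo (t₀ - θ * ρ ^ 2) t₀ ×ˢ ball (0 : EuclideanSpace ℝ (Fin 3)) (lam * ρ) ∧ Φ z.1 z.2 < l}
          ≤ ENNReal.ofReal μ₁ * volume (Ioo (t₀ - θ * ρ ^ 2) t₀ ×ˢ ball (0 : EuclideanSpace ℝ (Fin 3)) (lam * ρ)) →
        (∀ᵐ z ∂(volume.restrict (Ioo (t₀ - θ / 2 * ρ ^ 2) t₀ ×ˢ ball (0 : EuclideanSpace ℝ (Fin 3)) ρ)),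
            l / 2 ≤ Φ z.1 z.2) ∧
        ((∀ᵐ x ∂(volume.restrict (ball (0 : EuclideanSpace ℝ (Fin 3)) (lam * ρ))), l ≤ Φ (t₀ - θ * ρ ^ 2) x) →
          ∀ᵐ z ∂(volume.restrict (Ioo (t₀ - θ * ρ ^ 2) t₀ ×ˢ ball (0 : EuclideanSpace ℝ (Fin 3)) ρ)),
            l / 2 ≤ Φ z.1 z.2))
    (hEC : ∀ (U U' : ℝ → EuclideanSpace ℝ (Fin 3) → EuclideanSpace ℝ (Fin 3)) (Φ Φ' : ℝ → EuclideanSpace ℝ (Fin 3) → ℝ)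
      (S : Set (ℝ × EuclideanSpace ℝ (Fin 3))) (R k : ℝ) (N : ℝ≥0),
    ContinuousOn (uncurry U) {z : ℝ × EuclideanSpace ℝ (Fin 3) | z.1 < 0 ∧ cylRadius z.2 ≠ 0} →
    (∀ z : ℝ × EuclideanSpace ℝ (Fin 3), z.1 < 0 → cylRadius z.2 ≠ 0 → ContDiffAt ℝ (⊤ : ℕ∞) (U z.1) z.2) →
    ContinuousOn (fun z : ℝ × EuclideanSpace ℝ (Fin 3) => fderiv ℝ (U z.1) z.2) {z : ℝ × EuclideanSpace ℝ (Fin 3) | z.1 < 0 ∧ cylRadius z.2 ≠ 0} →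
    (∀ z : ℝ × EuclideanSpace ℝ (Fin 3), z.1 < 0 → cylRadius z.2 ≠ 0 → VectorCalculus.divergence (U z.1) z.2 = 0) →
    (∀ a : ℝ, 0 < a → ∫⁻ z in parabolicCylinder a (0 : ℝ × EuclideanSpace ℝ (Fin 3)), ‖U z.1 z.2‖ₑ ^ (3 : ℕ) < ∞) →
    IsClosed S → (∀ z ∈ S, z.1 ≤ 0 ∧ cylRadius z.2 = 0) → IsParabolicNull 1 S →
    ContinuousOn (uncurry Φ) ({z : ℝ × EuclideanSpace ℝ (Fin 3) | z.1 < 0} \ S) →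
    (∀ z : ℝ × EuclideanSpace ℝ (Fin 3), z.1 < 0 → z ∉ S → ContDiffAt ℝ (⊤ : ℕ∞) (Φ z.1) z.2) →
    ContinuousOn (fun z : ℝ × EuclideanSpace ℝ (Fin 3) => fderiv ℝ (Φ z.1) z.2) ({z : ℝ × EuclideanSpace ℝ (Fin 3) | z.1 < 0} \ S) →
    (∀ e : EuclideanSpace ℝ (Fin 3), ContinuousOn (fun z : ℝ × EuclideanSpace ℝ (Fin 3) => fderiv ℝ (fun y => fderiv ℝ (Φ z.1) y e) z.2 e)
      ({z : ℝ × EuclideanSpace ℝ (Fin 3) | z.1 < 0} \ S)) →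
    (∀ z : ℝ × EuclideanSpace ℝ (Fin 3), z.1 < 0 → cylRadius z.2 ≠ 0 → DifferentiableAt ℝ (fun r => Φ r z.2) z.1) →
    ContinuousOn (fun z : ℝ × EuclideanSpace ℝ (Fin 3) => deriv (fun r => Φ r z.2) z.1)
      {z : ℝ × EuclideanSpace ℝ (Fin 3) | z.1 < 0 ∧ cylRadius z.2 ≠ 0} →
    (∀ δ' ρ : ℝ, 0 < δ' → δ' < ρ → ∃ C : ℝ, ∀ z : ℝ × EuclideanSpace ℝ (Fin 3),
      z.1 ∈ Ioo (-ρ ^ 2) 0 → δ' < cylRadius z.2 → cylRadius z.2 < ρ → |z.2 2| < ρ →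
        |deriv (fun r => Φ r z.2) z.1| ≤ C ∧ ‖fderiv ℝ (Φ z.1) z.2‖ ≤ C ∧
        ∀ e : EuclideanSpace ℝ (Fin 3), ‖e‖ ≤ 1 → |fderiv ℝ (fun y => fderiv ℝ (Φ z.1) y e) z.2 e| ≤ C) →
    (∃ B : ℝ, ∀ z : ℝ × EuclideanSpace ℝ (Fin 3), z.1 < 0 → z ∉ S → |Φ z.1 z.2| ≤ B) →
    (∀ z : ℝ × EuclideanSpace ℝ (Fin 3), z.1 < 0 → z ∉ S → 0 ≤ Φ z.1 z.2) →
    (∀ z : ℝ × EuclideanSpace ℝ (Fin 3), z.1 < 0 → cylRadius z.2 ≠ 0 →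
      0 ≤ deriv (fun r => Φ r z.2) z.1 + fderiv ℝ (Φ z.1) z.2 (U z.1 z.2) +
          2 / cylRadius z.2 * partialDeriv (eR z.2) (Φ z.1) z.2 - (Laplacian.laplacian (Φ z.1)) z.2) →
    0 < R → 0 < k →
    (∫⁻ s in Ioo (-R ^ 2) 0, (∫⁻ y in ball (0 : EuclideanSpace ℝ (Fin 3)) (2 * R), ‖U s y‖ₑ ^ (3 : ℕ)) ^ (4 / 3 : ℝ) ≤
      (N : ℝ≥0∞) * ENNReal.ofReal R ^ 2) →
    (∀ z : ℝ × EuclideanSpace ℝ (Fin 3), z.1 ∈ Ioo (-R ^ 2) 0 → cylRadius z.2 = 0 →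
      z.2 2 ∈ Ioo (-(2 * R)) (2 * R) → z ∉ S → k ≤ Φ z.1 z.2) →
    (∀ t x, t < 0 → (t, x) ∉ S → Φ' t x = Φ t x) → (∀ t x, ¬ (t < 0 ∧ (t, x) ∉ S) → Φ' t x = k) →
    (∀ t x, t < 0 → cylRadius x ≠ 0 → U' t x = U t x) → (∀ t x, ¬ (t < 0 ∧ cylRadius x ≠ 0) → U' t x = 0) →
    (∀ (H : ℝ → ℝ), ContDiff ℝ 2 H → (∀ v, deriv H v ≤ 0) → (∀ v, 0 ≤ H v) → (∀ v, 0 ≤ deriv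
          (deriv H) v) → (∀ v, deriv H v ^ 2 ≤ 2 * H v * deriv (deriv H) v) → (∀ v, k ≤ v → H v = 0)
          → ∀ (Θ : EuclideanSpace ℝ (Fin 3) → ℝ), ContDiff ℝ 1 Θ → HasCompactSupport Θ → tsupport Θ
          ⊆ ball (0 : EuclideanSpace ℝ (Fin 3)) (2 * R) → ∀ (η : ℝ → ℝ), ContDiff ℝ 1 η → (∀ s, 0 ≤
          η s) → ∀ (t₁ t₂ : ℝ), -R ^ 2 < t₁ → t₁ ≤ t₂ → t₂ < 0 → ENNReal.ofReal (η t₂ * ∫ x, H (Φ' t₂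
          x) * Θ x ^ 2) + ∫⁻ z in Icc t₁ t₂ ×ˢ (univ : Set (EuclideanSpace ℝ (Fin 3))),
          ENNReal.ofReal (1 / 2 * η z.1 * (deriv (deriv H) (Φ' z.1 z.2) * ‖gradient (Φ' z.1) z.2‖ ^ 2
          * Θ z.2 ^ 2)) ≤ ENNReal.ofReal (η t₁ * (∫ x, H (Φ' t₁ x) * Θ x ^ 2) + (4 * ∫ z in Icc t₁ t₂
          ×ˢ (univ : Set (EuclideanSpace ℝ (Fin 3))), η z.1 * (H (Φ' z.1 z.2) * ‖gradient Θ z.2‖ ^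
          2)) + (∫ z in Icc t₁ t₂ ×ˢ (univ : Set (EuclideanSpace ℝ (Fin 3))), η z.1 * (H (Φ' z.1 z.2)
          * inner ℝ (U' z.1 z.2) (gradient (fun y => Θ y ^ 2) z.2))) + (∫ z in Icc t₁ t₂ ×ˢ (univ :
          Set (EuclideanSpace ℝ (Fin 3))), η z.1 * (2 / cylRadius z.2 * (H (Φ' z.1 z.2) * fderiv ℝ
          (fun y => Θ y ^ 2) z.2 (eR z.2)))) + (∫ z in Icc t₁ t₂ ×ˢ (univ : Set (EuclideanSpace ℝ
          (Fin 3))), |deriv η z.1| * (H (Φ' z.1 z.2) * Θ z.2 ^ 2))))) :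
    Seregin2020_axisymmetricSingularPoint_typeII :=
  fun u p G h₁ h₂ h₃ h₄ h₅ h₆ h₇ h₈ =>
    blowupIndex_eq_top_of_weakHarnack' u p G h₁ h₂ h₃ h₄ h₅ h₆ h₇ h₈ (lemma22_of_moser_and_energyClass hL31 hEC)

end Summit.NavierStokesRegularity.NavierStokesRegularity.Theorems.AxisymmetricKatoGlobal.EulerScaling

end
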